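import Literature.AlgebraicGeometry.GroupSchemes.BarsottiTateGroup
import HarnessLib

/-!
# Barsotti–Tate groups are stable under base change; so is the socket «`B = A[p^∞]`»

Topic `Literature/AlgebraicGeometry/GroupSchemes`; namespace `Literature.AlgebraicGeometry.GroupSchemes` (+ `BTGroup`).  Cell
`hodgecm-mathlib` (D-0151), FLOOR 0, P6 «MOD programme» generic organ L4.1-bis (sibling of ★ `BarsottiTateGroup` — the carrier
`BTGroup S p h` and the socket `BTGroup.IsOfAbelianScheme` — and of ★ `AbelianSchemes/PDivisibleGroupOfAbelianScheme`);
`--supports stmt-HodgeConjecture-24832`; COUNT-NEUTRAL: HC_CM is proved only modulo the 7 printed citations until rung 0 closes; this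
file discharges none of them.  ONE construction (`BTGroup.baseChange`) + theorems; no named fact, no instance, no notation, no `sorry`.

THE PRINT.  [Messing1972] Ch. I, (1.1)–(1.6): Barsotti–Tate groups over a base scheme `S` and their base change `G ×_S S'`
(every axiom — finite locally free layers of order `p^{nh}`, `G_n = G_{n+1}[p^n]`, `p : G_{n+1} ↠ G_n` — is fppf-local, hence
stable under arbitrary base change); [Tate1967] §2 (2.1); [GortzWedhorn2020] Section (4.7) (base change of `S`-schemes and of
`S`-group schemes, Remark 16.54).  This is the input shape of SERRE–TATE (MOD-PLAN L4B.1: «a lift of `A₀[p^∞]` along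
`S₀ ↪ S`» compares `B ×_S S₀` with `A₀[p^∞]`) and of every moduli-functor use of `A[p^∞]`.

WHAT IS HERE:
* §0 base change in `Over S` along `g : S' ⟶ S` (Mathlib `Over.pullback g`, cartesian-monoidal and braided):
  `isPullback_pullback_map_left` — the square `X ×_S S' →(φ ×_S S') Y ×_S S'` over `X →(φ) Y` is CARTESIAN, whence
  `of_pullback_map_left : P φ.left → P (φ ×_S S').left` for every `P` stable under base change; `eq_toUnit_comp_ε`,
  `pullback_map_toUnit` (the unit constraint `ε` is an iso); **`pullback_map_pow : (f ^ N) ×_S S' = (f ×_S S') ^ N`**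
  (`Functor.homMonoidHom`); **`isPullback_map_of_isPullback_unit`** — a KERNEL square `K → G →(f) M ←(e) S` base-changes to the
  kernel square of `f ×_S S'` against the unit section of the transported group law (`Functor.obj.η_def`, `IsPullback.of_iso`);
* §1 **`BTGroup.baseChange (B) (g) : BTGroup S' p h`** — layers `G n ×_S S'` with the transported group laws (`Functor.grpObjObj`),
  `incl n ×_S S'`, `pMap n ×_S S'`; all nineteen axioms discharged (rank by `Scheme.Hom.finrank_pullback_snd`; commutativity by
  `Functor.isCommMonObj_obj`; homomorphisms by `Functor.map.instIsMonHom`); unfolding lemmas `baseChange_G ∕ _G_left ∕ _hom ∕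
  _grpObj ∕ _incl ∕ _pMap` (`rfl`);
* §2 **`BTGroup.IsOfAbelianScheme.baseChange : B.IsOfAbelianScheme A → (B.baseChange g).IsOfAbelianScheme (A.baseChange g)`**
  (★ `AbelianSchemeOver.baseChange`, whose group law is the same `Functor.grpObjObj`).

NOT HERE: the category of Barsotti–Tate groups (morphisms ∕ isomorphisms of `BTGroup`s, uniqueness of `A[p^∞]` up to
isomorphism), transitivity isomorphisms `(B ×_S S') ×_{S'} S'' ≅ B ×_S S''`.

## References
* [Messing1972] W. Messing, *The Crystals Associated to Barsotti–Tate Groups*, LNM 264 (1972) — Ch. I (1.1)–(1.6).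
* [Tate1967] J. T. Tate, *p-divisible groups*, Proc. Conf. Local Fields (Driebergen 1966), Springer 1967 — §2 (2.1).
* [GortzWedhorn2020] U. Görtz, T. Wedhorn, *Algebraic Geometry I*, 2nd ed. (2020) — Section (4.7) (pp. 107–108), Remark 16.54.
-/

noncomputable section

universe u

open CategoryTheory CategoryTheory.Limits AlgebraicGeometry MonoidalCategory CartesianMonoidalCategory
open scoped MonObj CategoryTheory.Obj

namespace Literature.AlgebraicGeometry.GroupSchemes

/-! ## §0 Base change in `Over S` along `g : S' ⟶ S`: underlying squares and the unit -/

section OverPullback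

variable {S S' : Scheme.{u}} (g : S' ⟶ S)

/-- For `φ : X ⟶ Y` over `S`, the underlying square of schemes `X ×_S S' →(φ ×_S S') Y ×_S S'` over `X →(φ) Y` (with the first
projections) is CARTESIAN. [cite: GortzWedhorn2020, Section (4.7) (pp. 107–108)] -/
theorem isPullback_pullback_map_left {X Y : Over S} (φ : X ⟶ Y) :
    IsPullback (pullback.fst X.hom g) ((Over.pullback g).map φ).left φ.left (pullback.fst Y.hom g) := by
  have efst : ((Over.pullback g).map φ).left ≫ pullback.fst Y.hom g = pullback.fst X.hom g ≫ φ.left :=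
    (congrArg (· ≫ pullback.fst Y.hom g) (Over.pullback_map_left g X (k := φ))).trans (pullback.lift_fst _ _ _)
  have esnd : ((Over.pullback g).map φ).left ≫ pullback.snd Y.hom g = pullback.snd X.hom g :=
    (congrArg (· ≫ pullback.snd Y.hom g) (Over.pullback_map_left g X (k := φ))).trans (pullback.lift_snd _ _ _)
  have s : IsPullback (pullback.fst X.hom g) (((Over.pullback g).map φ).left ≫ pullback.snd Y.hom g)
      (φ.left ≫ Y.hom) g :=
    (IsPullback.of_hasPullback X.hom g).of_iso (Iso.refl _) (Iso.refl _) (Iso.refl _) (Iso.refl _)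
      (by simp) (by rw [Iso.refl_hom, Iso.refl_hom, Category.comp_id, Category.id_comp]; exact esnd.symm)
      (by rw [Iso.refl_hom, Iso.refl_hom, Category.comp_id, Category.id_comp]; exact (Over.w φ).symm) (by simp)
  exact s.of_bot efst.symm (IsPullback.of_hasPullback Y.hom g)

/-- Base change along `g` of a property of morphisms of schemes stable under base change, for `S`-morphisms: `P φ → P (φ ×_S S')`.
[cite: GortzWedhorn2020, Section (4.7) (pp. 107–108)] -/
theorem of_pullback_map_left {P : MorphismProperty Scheme.{u}} [P.IsStableUnderBaseChange] {X Y : Over S} (φ : X ⟶ Y)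
    (hφ : P φ.left) : P ((Over.pullback g).map φ).left :=
  MorphismProperty.of_isPullback (isPullback_pullback_map_left g φ) hφ

/-- The monoidal unit constraint of the base-change functor: `ε : 𝟙_ (Over S') ⟶ (S ×_S S')` is an isomorphism, so every
morphism into `(Over.pullback g).obj (𝟙_ (Over S))` is `toUnit _ ≫ ε`. [cite: GortzWedhorn2020, Section (4.7) (pp. 107–108)] -/
theorem eq_toUnit_comp_ε {X : Over S'} (f : X ⟶ (Over.pullback g).obj (𝟙_ (Over S))) :
    f = toUnit X ≫ Functor.LaxMonoidal.ε (Over.pullback g) := by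
  rw [← cancel_mono (inv (Functor.LaxMonoidal.ε (Over.pullback g)))]
  exact toUnit_unique _ _

/-- `(Over.pullback g).map (toUnit X) = toUnit _ ≫ ε`. [cite: GortzWedhorn2020, Section (4.7) (pp. 107–108)] -/
theorem pullback_map_toUnit (X : Over S) :
    (Over.pullback g).map (toUnit X) = toUnit _ ≫ Functor.LaxMonoidal.ε (Over.pullback g) :=
  eq_toUnit_comp_ε g _

/-- **Base change of powers in the `Hom`-monoid**: `(f ^ N) ×_S S' = (f ×_S S') ^ N` for `f : X ⟶ M` into an `S`-group
scheme (the base-change functor is monoidal, Mathlib `Functor.homMonoidHom`). [cite: GortzWedhorn2020, Section (4.7) (pp. 107–108)] -/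
theorem pullback_map_pow {X M : Over S} [MonObj M] (f : X ⟶ M) (N : ℕ) :
    (Over.pullback g).map (f ^ N) = ((Over.pullback g).map f) ^ N :=
  map_pow ((Over.pullback g).homMonoidHom) f N

/-- **Base change of a KERNEL SQUARE**: if `K →(i) G →(f) M ←(e) S` is cartesian in `Over S` (i.e. `K = Ker f`), then so is
`K ×_S S' → G ×_S S' →(f ×_S S') M ×_S S' ←(e) S'` in `Over S'` (the base-change functor is a right adjoint and carries the
unit section to the unit section). [cite: GortzWedhorn2020, Section (4.7) (pp. 107–108)] -/
theorem isPullback_map_of_isPullback_unit {K G M : Over S} [MonObj M] {i : K ⟶ G} {f : G ⟶ M}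
    (h : IsPullback i (toUnit K) f η[M]) :
    IsPullback ((Over.pullback g).map i) (toUnit _) ((Over.pullback g).map f) η[(Over.pullback g).obj M] := by
  have h' := h.map (Over.pullback g)
  refine h'.of_iso (Iso.refl _) (Iso.refl _) (asIso (Functor.LaxMonoidal.ε (Over.pullback g))).symm (Iso.refl _)
    (by simp) ?_ (by simp) ?_
  · rw [Iso.refl_hom, Category.id_comp, Iso.symm_hom, asIso_inv, IsIso.comp_inv_eq, pullback_map_toUnit]
  · rw [Iso.refl_hom, Category.comp_id, Iso.symm_hom, asIso_inv, IsIso.eq_inv_comp, Functor.obj.η_def]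

end OverPullback

/-! ## §1 Base change of a Barsotti–Tate group -/

namespace BTGroup

variable {S S' : Scheme.{u}} {p h : ℕ} (B : BTGroup S p h) (g : S' ⟶ S)

/-- **BASE CHANGE OF A BARSOTTI–TATE GROUP** along `g : S' ⟶ S`: the layers `G n ×_S S'` with the transported group laws
(Mathlib `Functor.grpObjObj` for the cartesian-monoidal `Over.pullback g`), transitions `incl n ×_S S'` and `[p]`-maps
`pMap n ×_S S'`; every axiom of the carrier is stable under base change (finite, flat, rank — `Scheme.Hom.finrank_pullback_snd`;
closed immersion, flat, surjective — base change along the cartesian squares `isPullback_pullback_map_left`; the kernel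
square — `isPullback_map_of_isPullback_unit`; `killed`∕`pMap_incl` — `Functor.homMonoidHom`). [cite: Messing1972, Ch. I (1.1)–(1.6)] -/
def baseChange : BTGroup S' p h where
  G n := (Over.pullback g).obj (B.G n)
  grpObj n := letI := B.grpObj n; Functor.grpObjObj (F := Over.pullback g)
  comm n := by
    letI := B.grpObj n
    haveI := B.comm n
    exact Functor.isCommMonObj_obj
  isFinite n := by
    haveI := B.isFinite n
    change IsFinite (pullback.snd (B.G n).hom g)
    infer_instance
  flat n := by
    haveI := B.flat n
    change Flat (pullback.snd (B.G n).hom g)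
    infer_instance
  finrank_eq n s := by
    haveI := B.isFinite n
    haveI := B.flat n
    change Scheme.Hom.finrank (pullback.snd (B.G n).hom g) s = _
    rw [Scheme.Hom.finrank_pullback_snd]
    exact B.finrank_eq n _
  killed n := by
    letI := B.grpObj n
    rw [← (Over.pullback g).map_id, ← pullback_map_pow, B.killed n, Functor.map_one]
  incl n := (Over.pullback g).map (B.incl n)
  incl_isMonHom n := by
    letI := B.grpObj n
    letI := B.grpObj (n + 1)
    haveI := B.incl_isMonHom n
    infer_instance
  isClosedImmersion_incl n := of_pullback_map_left g (P := @IsClosedImmersion) _ (B.isClosedImmersion_incl n)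
  isPullback_incl n := by
    letI := B.grpObj (n + 1)
    have h := isPullback_map_of_isPullback_unit g (B.isPullback_incl n)
    rwa [pullback_map_pow, (Over.pullback g).map_id] at h
  pMap n := (Over.pullback g).map (B.pMap n)
  pMap_incl n := by
    letI := B.grpObj (n + 1)
    rw [← (Over.pullback g).map_comp, B.pMap_incl n, pullback_map_pow, (Over.pullback g).map_id]
  pMap_isMonHom n := by
    letI := B.grpObj n
    letI := B.grpObj (n + 1)
    haveI := B.pMap_isMonHom n
    infer_instance
  flat_pMap n := of_pullback_map_left g (P := @Flat) _ (B.flat_pMap n)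
  surjective_pMap n := of_pullback_map_left g (P := @Surjective) _ (B.surjective_pMap n)

/-- The layers of `B ×_S S'` are the `G n ×_S S'` (unfolding). [cite: Messing1972, Ch. I (1.1)–(1.6)] -/
@[simp]
theorem baseChange_G (n : ℕ) : (B.baseChange g).G n = (Over.pullback g).obj (B.G n) := rfl

/-- The underlying scheme of the `n`-th layer of `B ×_S S'` is `G n ×_S S'`. [cite: Messing1972, Ch. I (1.1)–(1.6)] -/
theorem baseChange_G_left (n : ℕ) : ((B.baseChange g).G n).left = Limits.pullback (B.G n).hom g := rfl

/-- The structure morphism of the `n`-th layer of `B ×_S S'` is the second projection. [cite: Messing1972, Ch. I (1.1)–(1.6)] -/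
theorem baseChange_hom (n : ℕ) : (B.baseChange g).hom n = pullback.snd (B.G n).hom g := rfl

/-- The group laws of `B ×_S S'` are the transported ones (`Functor.grpObjObj`). [cite: Messing1972, Ch. I (1.1)–(1.6)] -/
theorem baseChange_grpObj (n : ℕ) :
    (B.baseChange g).grpObj n = (letI := B.grpObj n; Functor.grpObjObj (F := Over.pullback g)) := rfl

/-- The transitions of `B ×_S S'` are `incl n ×_S S'`. [cite: Messing1972, Ch. I (1.1)–(1.6)] -/
@[simp]
theorem baseChange_incl (n : ℕ) : (B.baseChange g).incl n = (Over.pullback g).map (B.incl n) := rfl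

/-- The `[p]`-maps of `B ×_S S'` are `pMap n ×_S S'`. [cite: Messing1972, Ch. I (1.1)–(1.6)] -/
@[simp]
theorem baseChange_pMap (n : ℕ) : (B.baseChange g).pMap n = (Over.pullback g).map (B.pMap n) := rfl

/-! ## §2 The socket «`B = A[p^∞]`» is stable under base change -/

/-- **If `B = A[p^∞]` then `B ×_S S' = (A ×_S S')[p^∞]`**: the socket `IsOfAbelianScheme` is stable under base change
(★ `AbelianSchemeOver.baseChange`; the kernel squares, the homomorphisms `i n` and the compatibilities `incl n ≫ i (n+1) = i n`
all base-change). [cite: Messing1972, Ch. I (1.1)–(1.6)] -/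
theorem IsOfAbelianScheme.baseChange {A : AbelianSchemes.AbelianSchemeOver S} {B : BTGroup S p h}
    (hB : B.IsOfAbelianScheme A) : (B.baseChange g).IsOfAbelianScheme (A.baseChange g) := by
  obtain ⟨i, hi, hsq, hcomp⟩ := hB
  refine ⟨fun n => (Over.pullback g).map (i n), fun n => ?_, fun n => ?_, fun n => ?_⟩
  · letI := B.grpObj n
    haveI := hi n
    change IsMonHom ((Over.pullback g).map (i n))
    infer_instance
  · have h := isPullback_map_of_isPullback_unit g (hsq n)
    rw [pullback_map_pow, (Over.pullback g).map_id] at h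
    exact h
  · change (Over.pullback g).map (B.incl n) ≫ (Over.pullback g).map (i (n + 1)) = _
    rw [← (Over.pullback g).map_comp, hcomp]

end BTGroup

/-! ## §3 The base-change RELATION `IsBaseChangeVia` (any cartesian square of BT groups, not only the chosen pull-back) -/

section Relation

variable {S S' : Scheme.{u}} (g : S' ⟶ S)

/-- On underlying schemes, the unit section of the transported group law on `X ×_S S'` followed by the projection to `X` is
`g` followed by the unit section of `X` (the transported unit is `ε ≫ (Over.pullback g).map η`; Mathlib `Over.ε_pullback_left`).
Generic-`X` edition of ★ `AbelianSchemeOver.one_baseChange_left_comp_fst` (B-p13), whose proof is adapted here.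
[cite: GortzWedhorn2020, Section (4.7) (pp. 107–108)] -/
theorem one_pullback_obj_left_comp_fst (X : Over S) [MonObj X] :
    η[(Over.pullback g).obj X].left ≫ pullback.fst X.hom g = g ≫ η[X].left := by
  have h1 : η[(Over.pullback g).obj X].left =
      (Functor.LaxMonoidal.ε (Over.pullback g)).left ≫ ((Over.pullback g).map η[X]).left := rfl
  have h3 : ((Over.pullback g).map η[X]).left ≫ pullback.fst X.hom g = pullback.fst (𝟙 S) g ≫ η[X].left :=
    pullback.lift_fst _ _ _
  have h4 : (Functor.LaxMonoidal.ε (Over.pullback g)).left = inv (pullback.snd (𝟙 S) g) := Over.ε_pullback_left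
  have h2 : pullback.fst (𝟙 S) g = pullback.snd (𝟙 S) g ≫ g := (Category.comp_id _).symm.trans pullback.condition
  have h5 : inv (pullback.snd (𝟙 S) g) ≫ pullback.fst (𝟙 S) g = g := (IsIso.inv_comp_eq _).mpr h2
  calc η[(Over.pullback g).obj X].left ≫ pullback.fst X.hom g
      = ((Functor.LaxMonoidal.ε (Over.pullback g)).left ≫ ((Over.pullback g).map η[X]).left) ≫ pullback.fst X.hom g :=
          congrArg (· ≫ pullback.fst X.hom g) h1
    _ = (Functor.LaxMonoidal.ε (Over.pullback g)).left ≫ (((Over.pullback g).map η[X]).left ≫ pullback.fst X.hom g) :=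
          Category.assoc _ _ _
    _ = (Functor.LaxMonoidal.ε (Over.pullback g)).left ≫ (pullback.fst (𝟙 S) g ≫ η[X].left) := congrArg _ h3
    _ = inv (pullback.snd (𝟙 S) g) ≫ (pullback.fst (𝟙 S) g ≫ η[X].left) :=
          congrArg (· ≫ (pullback.fst (𝟙 S) g ≫ η[X].left)) h4
    _ = (inv (pullback.snd (𝟙 S) g) ≫ pullback.fst (𝟙 S) g) ≫ η[X].left := (Category.assoc _ _ _).symm
    _ = g ≫ η[X].left := congrArg (· ≫ η[X].left) h5

/-- On underlying schemes, the transported group law of `X ×_S S'` followed by the projection to `X` is the projection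
`(X ×_S S') ×_{S'} (X ×_S S') → X ×_S X` followed by the group law of `X` (Mathlib `Over.μ_pullback_left_fst_fst ∕ _fst_snd`).
Generic-`X` edition of ★ `AbelianSchemeOver.mul_baseChange_left_comp_fst` (B-p13), proof adapted.
[cite: GortzWedhorn2020, Section (4.7) (pp. 107–108)] -/
theorem mul_pullback_obj_left_comp_fst (X : Over S) [MonObj X]
    (w : pullback.fst X.hom g ≫ X.hom = ((Over.pullback g).obj X).hom ≫ g) :
    μ[(Over.pullback g).obj X].left ≫ pullback.fst X.hom g =
      pullback.map ((Over.pullback g).obj X).hom ((Over.pullback g).obj X).hom X.hom X.hom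
        (pullback.fst X.hom g) (pullback.fst X.hom g) g w.symm w.symm ≫ μ[X].left := by
  have h1 : μ[(Over.pullback g).obj X].left =
      (Functor.LaxMonoidal.μ (Over.pullback g) X X).left ≫ ((Over.pullback g).map μ[X]).left := rfl
  have h3 : ((Over.pullback g).map μ[X]).left ≫ pullback.fst X.hom g = pullback.fst (X ⊗ X).hom g ≫ μ[X].left :=
    pullback.lift_fst _ _ _
  have h4 : (Functor.LaxMonoidal.μ (Over.pullback g) X X).left ≫ pullback.fst (X ⊗ X).hom g =
      pullback.map ((Over.pullback g).obj X).hom ((Over.pullback g).obj X).hom X.hom X.hom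
        (pullback.fst X.hom g) (pullback.fst X.hom g) g w.symm w.symm := by
    apply pullback.hom_ext
    · exact (Category.assoc _ _ _).trans ((Over.μ_pullback_left_fst_fst X X).trans (pullback.lift_fst _ _ _).symm)
    · exact (Category.assoc _ _ _).trans ((Over.μ_pullback_left_fst_snd X X).trans (pullback.lift_snd _ _ _).symm)
  calc μ[(Over.pullback g).obj X].left ≫ pullback.fst X.hom g
      = ((Functor.LaxMonoidal.μ (Over.pullback g) X X).left ≫ ((Over.pullback g).map μ[X]).left) ≫
          pullback.fst X.hom g := congrArg (· ≫ pullback.fst X.hom g) h1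
    _ = (Functor.LaxMonoidal.μ (Over.pullback g) X X).left ≫
          (((Over.pullback g).map μ[X]).left ≫ pullback.fst X.hom g) := Category.assoc _ _ _
    _ = (Functor.LaxMonoidal.μ (Over.pullback g) X X).left ≫ (pullback.fst (X ⊗ X).hom g ≫ μ[X].left) := congrArg _ h3
    _ = ((Functor.LaxMonoidal.μ (Over.pullback g) X X).left ≫ pullback.fst (X ⊗ X).hom g) ≫ μ[X].left :=
          (Category.assoc _ _ _).symm
    _ = _ := congrArg (· ≫ μ[X].left) h4

end Relation

namespace BTGroup

variable {S S' : Scheme.{u}} {p h : ℕ}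

/-- **`G : B' → B` over `g : S' ⟶ S` exhibits the Barsotti–Tate group `B'/S'` as the base change of `B/S` AS GROUP SCHEMES,
LAYERWISE**: for every `n` the square `(G n, g)` is cartesian and `G n` is compatible with the unit sections and the group
laws (so `B'.G n ≅ B.G n ×_S S'` as `S'`-group schemes), and the `G n` commute with the transitions `incl` (then also with
the `pMap`, by `pMap_incl` and the monomorphism `incl`).  Verbatim the shape of ★ `AbelianSchemeOver.IsBaseChangeVia`, one
layer at a time — ANY pull-back square qualifies, not only the chosen `BTGroup.baseChange` (the currency in which
Serre–Tate compares `B ×_S S₀` with `A₀[p^∞]`). [cite: Messing1972, Ch. I (1.1)–(1.6)] -/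
def IsBaseChangeVia (B' : BTGroup S' p h) (B : BTGroup S p h) (g : S' ⟶ S)
    (G : ∀ n, (B'.G n).left ⟶ (B.G n).left) : Prop :=
  (∀ n, ∃ w : G n ≫ (B.G n).hom = (B'.G n).hom ≫ g,
    IsPullback (G n) (B'.G n).hom (B.G n).hom g ∧
    (letI := B'.grpObj n; η[B'.G n].left) ≫ G n = g ≫ (letI := B.grpObj n; η[B.G n].left) ∧
    (letI := B'.grpObj n; μ[B'.G n].left) ≫ G n =
      pullback.map (B'.G n).hom (B'.G n).hom (B.G n).hom (B.G n).hom (G n) (G n) g w.symm w.symm ≫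
        (letI := B.grpObj n; μ[B.G n].left)) ∧
  ∀ n, (B'.incl n).left ≫ G (n + 1) = G n ≫ (B.incl n).left

/-- The identity is a base change of Barsotti–Tate groups (sanity check of `IsBaseChangeVia`; the pattern of ★
`AbelianSchemeOver.IsBaseChangeVia.refl`). [cite: Messing1972, Ch. I (1.1)–(1.6)] -/
theorem IsBaseChangeVia.refl (B : BTGroup S p h) : B.IsBaseChangeVia B (𝟙 S) (fun n => 𝟙 (B.G n).left) := by
  refine ⟨fun n => ⟨by simp, IsPullback.of_horiz_isIso ⟨by simp⟩, by simp, ?_⟩, fun n => by simp⟩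
  letI := B.grpObj n
  rw [Category.comp_id]
  conv_lhs => rw [← Category.id_comp (μ[B.G n].left)]
  congr 1
  apply pullback.hom_ext <;> simp

/-- **The chosen base change IS a base change**: the first projections `G n ×_S S' → G n` exhibit `B.baseChange g` as the
pull-back of `B` along `g` in the sense of `IsBaseChangeVia` (cartesian squares ✓, units ✓, group laws ✓, transitions ✓).
[cite: Messing1972, Ch. I (1.1)–(1.6)] -/
theorem isBaseChangeVia_baseChange (B : BTGroup S p h) (g : S' ⟶ S) :
    (B.baseChange g).IsBaseChangeVia B g (fun n => pullback.fst (B.G n).hom g) := by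
  refine ⟨fun n => ⟨pullback.condition, IsPullback.of_hasPullback (B.G n).hom g, ?_, ?_⟩, fun n => ?_⟩
  · letI := B.grpObj n
    exact one_pullback_obj_left_comp_fst g (B.G n)
  · letI := B.grpObj n
    exact mul_pullback_obj_left_comp_fst g (B.G n) pullback.condition
  · exact (congrArg (· ≫ pullback.fst (B.G (n + 1)).hom g) (Over.pullback_map_left g (B.G n) (k := B.incl n))).trans
      (pullback.lift_fst _ _ _)

end BTGroup

end Literature.AlgebraicGeometry.GroupSchemes

end
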